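import Literature.NumberTheory.Automorphic.LevelActionSectionsExact
import Mathlib.RepresentationTheory.Basic
import Mathlib.RingTheory.Flat.Basic
import HarnessLib

/-!
# Induced coefficient systems along a finite quotient of levels (the functor `𝓕`)

Topic `NumberTheory/Automorphic`; namespace `Literature.NumberTheory.Automorphic.LevelAction`;
definitions with bodies and theorems, no named fact, no instance, no `sorry`.  Universe `0`.

Setting: a level `U' ≤ 𝒢` contained in the coefficient monoid `Δ` of the coefficients-at-`p`
model (`IntegralWeightHeckeModuleGL2`: `τ : Δ →* End V`, sections `M(U', τ)`), and a
homomorphism `π : U' →* Q` onto a (finite, in the applications abelian) group `Q` — the torus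
quotient `U(c, c')/U(c', c') ≅ T(c)/T(c')` of two Hida levels, acting by diamonds.  For a
representation `ρ` of `Q` on an `R`-module `N` we form the COEFFICIENT SYSTEM
`N ⊗_R V` with `u ↦ ρ(π u) ⊗ τ(u)` (`inducedCoeff`) and its sections / `Γ`-representation
`𝓕(N) = M(U', N ⊗ V)` (`inducedRep`).  This is the device by which every auxiliary module of the
finite-level control (invariants, coinvariants, the augmentation filtration of the small-level
sections, their sums and quotients) is again "a local system at level `U'`", so that finiteness
and vanishing theorems for level-`U'` cohomology apply to all of them uniformly
([KhareThorne2017, §6.3, Lemma 6.9]: `C(U', M) ⊗_{𝒪[Δ̄]} -`).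

* `inducedCoeff`, `inducedRep`, `inducedMap` (functoriality in `Q`-equivariant maps of `N`),
  `inducedMap_id/comp/zero/add/sub/sum`;
* **`shortExact_inducedMap`** — `𝓕` is exact (for `V` flat over `R`: a short exact sequence of
  `Q`-modules gives a short exact sequence of `Γ`-representations; `shortExact_pushforward` +
  `Module.Flat.rTensor_exact`);
* **`inducedHecke`** — the `U_p`-type operator `F ↦ (g ↦ ∑_j (1 ⊗ τ(α_j)) F(g α_j))` on
  `𝓕(N)` attached to a finite family of elements `α_j ∈ Δ` that `U'` permutes up to right
  multiplication by elements `u_j ∈ U'` WITH THE SAME IMAGE IN `Q` (`IsAdaptedFamily`; for the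
  Iwahori levels and the unipotent representatives `(ϖ j; 0 1)` of `U_p` this is the congruence
  of the diagonals of `α_{j'}⁻¹ u α_j` and `u`), as an endomorphism of `Γ`-representations,
  NATURAL in `N` (`inducedHecke_comp_inducedMap`) — so that `U_p` acts compatibly on the whole
  diagram of auxiliary modules and on the long exact sequences between their cohomologies.

The identification of `𝓕(R[Q])` with the sections at the small level `ker π`, of `𝓕(R)` with
`M(U', τ)`, and of `inducedHecke` with the Hecke operators there, is in
`LevelActionInducedRegular`.

## References

* C. Khare, J. A. Thorne, Amer. J. Math. 139 (2017), §6.3 (Lemma 6.5, Lemma 6.9, Prop. 6.6).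
  [KhareThorne2017]
* H. Hida, Duke Math. J. 69 (1993), §5; Ann. Inst. Fourier 44 (1994), §1–§2. [Hida1994AIF]
-/

noncomputable section

open CategoryTheory
open scoped TensorProduct

namespace Literature.NumberTheory.Automorphic

namespace LevelAction

/-- **An adapted family of Hecke representatives**: elements `α_j ∈ Δ` (`j` in a finite index
type) such that every `u ∈ U'` permutes them up to right multiplication by elements of `U'`
having THE SAME IMAGE IN `Q` as `u`: `u α_j = α_{σ j} u_j`, `u_j ∈ U'`, `π(u_j) = π(u)`.  (For the
Iwahori levels `U' = U(c, c')`, `Q = T(c)/T(c')` and the unipotent representatives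
`α_j = (ϖ j; 0 1)` of `U' diag(ϖ, 1) U'`: the diagonal of `α_{j'}⁻¹ u α_j` is congruent to that
of `u`.) [cite: KhareThorne2017, §6.3, Lemma 6.5 (2)] -/
structure IsAdaptedFamily {𝒢 : Type} [Group 𝒢] (Δ : Submonoid 𝒢) (U' : Subgroup 𝒢) {Q : Type}
    [Group Q] (π : U' →* Q) {J : Type} [Fintype J] (a : J → 𝒢) : Prop where
  mem : ∀ j, a j ∈ Δ
  perm : ∀ u : U', ∃ σ : Equiv.Perm J, ∀ j, ∃ u' : U', (u : 𝒢) * a j = a (σ j) * u' ∧ π u' = π u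


variable {R : Type} [CommRing R] {Γ 𝒢 : Type} [Group Γ] [Group 𝒢] (ι : Γ →* 𝒢)
  {Δ : Submonoid 𝒢} {V : Type} [AddCommGroup V] [Module R V] (τ : Δ →* Module.End R V)
  {U' : Subgroup 𝒢} (hU' : U'.toSubmonoid ≤ Δ) {Q : Type} [Group Q] (π : U' →* Q)

/-! ### The induced coefficient system `N ⊗ V` -/

section Coeff

variable {N N' N'' : Type} [AddCommGroup N] [Module R N] [AddCommGroup N'] [Module R N']
  [AddCommGroup N''] [Module R N'']
  (ρ : Representation R Q N) (ρ' : Representation R Q N') (ρ'' : Representation R Q N'')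

/-- The tautological homomorphism `U'.toSubmonoid →* U'` (same elements). [folklore] -/
def toSubgroupHom (U' : Subgroup 𝒢) : U'.toSubmonoid →* U' where
  toFun u := ⟨u.1, u.2⟩
  map_one' := rfl
  map_mul' _ _ := rfl

/-- Unfolding `toSubgroupHom`. [folklore] -/
@[simp]
theorem coe_toSubgroupHom_apply (u : U'.toSubmonoid) : ((toSubgroupHom U' u : U') : 𝒢) = u := rfl

/-- **The coefficient system `N ⊗_R V` of level `U'`**: `u ↦ ρ(π u) ⊗ τ(u)` on the submonoid
`U'` (the tensor product representation `Representation.tprod` of `ρ ∘ π` and `τ|U'`).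
[cite: KhareThorne2017, §6.3 (Lemma 6.9)] -/
def inducedCoeff : U'.toSubmonoid →* Module.End R (N ⊗[R] V) :=
  Representation.tprod (ρ.comp (π.comp (toSubgroupHom U')))
    (show Representation R U'.toSubmonoid V from τ.comp (Submonoid.inclusion hU'))

/-- Unfolding `inducedCoeff` on a pure tensor. [folklore] -/
@[simp]
theorem inducedCoeff_apply_tmul (u : U'.toSubmonoid) (n : N) (v : V) :
    inducedCoeff τ hU' π ρ u (n ⊗ₜ v) =
      ρ (π (toSubgroupHom U' u)) n ⊗ₜ τ (Submonoid.inclusion hU' u) v :=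
  rfl

/-- `U' ⊆ U'` as submonoids (the level hypothesis of the sections of `inducedCoeff`). [folklore] -/
theorem level_le_self : U'.toSubmonoid ≤ U'.toSubmonoid := le_rfl

/-- **`𝓕(N)`, the `Γ`-representation of sections of the induced coefficient system** (left
translation on `M(U', N ⊗ V)`). [cite: KhareThorne2017, §6.3 (Lemma 6.9)] -/
abbrev inducedRep : Rep R Γ :=
  Rep.of (rep ι U'.toSubmonoid (inducedCoeff τ hU' π ρ) U')

/-- **`H^i(Γ, 𝓕(N))`.** [folklore] -/
abbrev inducedCohomology (i : ℕ) : ModuleCat R :=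
  cohomology ι U'.toSubmonoid (inducedCoeff τ hU' π ρ) U' i

variable {ρ ρ' ρ''}

/-- A `Q`-equivariant map of coefficients `φ : N → N'` tensored with `V` is equivariant for the
induced coefficient systems. [folklore] -/
theorem rTensor_equivariant (φ : N →ₗ[R] N') (hφ : ∀ q : Q, φ ∘ₗ ρ q = ρ' q ∘ₗ φ)
    (u : U'.toSubmonoid) :
    φ.rTensor V ∘ₗ inducedCoeff τ hU' π ρ u = inducedCoeff τ hU' π ρ' u ∘ₗ φ.rTensor V := by
  refine TensorProduct.ext' fun n v => ?_
  simp only [LinearMap.comp_apply, inducedCoeff_apply_tmul, LinearMap.rTensor_tmul]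
  rw [← LinearMap.comp_apply, hφ, LinearMap.comp_apply]

variable (ρ ρ') in
/-- **`𝓕(φ) : 𝓕(N) → 𝓕(N')`** for a `Q`-equivariant `φ : N → N'` (push-forward along `φ ⊗ 1`).
[cite: KhareThorne2017, §6.3] -/
def inducedMap (φ : N →ₗ[R] N') (hφ : ∀ q : Q, φ ∘ₗ ρ q = ρ' q ∘ₗ φ) :
    inducedRep ι τ hU' π ρ ⟶ inducedRep ι τ hU' π ρ' :=
  pushforward ι U'.toSubmonoid (inducedCoeff τ hU' π ρ) (inducedCoeff τ hU' π ρ') U'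
    (φ.rTensor V) (rTensor_equivariant τ hU' π φ hφ)

/-- Unfolding `inducedMap` pointwise. [folklore] -/
@[simp]
theorem inducedMap_hom_apply_coe (φ : N →ₗ[R] N') (hφ : ∀ q : Q, φ ∘ₗ ρ q = ρ' q ∘ₗ φ)
    (f : inducedRep ι τ hU' π ρ) (g : 𝒢) :
    (((inducedMap ι τ hU' π ρ ρ' φ hφ).hom f :
      sections U'.toSubmonoid (inducedCoeff τ hU' π ρ') U') : 𝒢 → N' ⊗[R] V) g =
      φ.rTensor V ((f : 𝒢 → N ⊗[R] V) g) :=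
  rfl

/-- The identity is equivariant. [folklore] -/
theorem id_equivariant' (q : Q) : LinearMap.id ∘ₗ ρ q = ρ q ∘ₗ LinearMap.id := by
  rw [LinearMap.id_comp, LinearMap.comp_id]

/-- `𝓕(id) = 𝟙`. [folklore] -/
theorem inducedMap_id :
    inducedMap ι τ hU' π ρ ρ LinearMap.id (id_equivariant' (ρ := ρ)) = 𝟙 _ := by
  refine Rep.hom_ext (Representation.IntertwiningMap.ext (LinearMap.ext fun f => Subtype.ext
    (funext fun g => ?_)))
  change LinearMap.rTensor V LinearMap.id ((f : 𝒢 → N ⊗[R] V) g) = (f : 𝒢 → N ⊗[R] V) g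
  rw [LinearMap.rTensor_id, LinearMap.id_apply]

/-- Composites of equivariant maps are equivariant. [folklore] -/
theorem comp_equivariant' {φ : N →ₗ[R] N'} {ψ : N' →ₗ[R] N''}
    (hφ : ∀ q : Q, φ ∘ₗ ρ q = ρ' q ∘ₗ φ) (hψ : ∀ q : Q, ψ ∘ₗ ρ' q = ρ'' q ∘ₗ ψ) (q : Q) :
    (ψ ∘ₗ φ) ∘ₗ ρ q = ρ'' q ∘ₗ (ψ ∘ₗ φ) := by
  rw [LinearMap.comp_assoc, hφ, ← LinearMap.comp_assoc, hψ, LinearMap.comp_assoc]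

/-- **`𝓕(ψ ∘ φ) = 𝓕(φ) ≫ 𝓕(ψ)`.** [folklore] -/
theorem inducedMap_comp (φ : N →ₗ[R] N') (ψ : N' →ₗ[R] N'')
    (hφ : ∀ q : Q, φ ∘ₗ ρ q = ρ' q ∘ₗ φ) (hψ : ∀ q : Q, ψ ∘ₗ ρ' q = ρ'' q ∘ₗ ψ) :
    inducedMap ι τ hU' π ρ ρ'' (ψ ∘ₗ φ) (comp_equivariant' hφ hψ) =
      inducedMap ι τ hU' π ρ ρ' φ hφ ≫ inducedMap ι τ hU' π ρ' ρ'' ψ hψ := by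
  refine Rep.hom_ext (Representation.IntertwiningMap.ext (LinearMap.ext fun f => Subtype.ext
    (funext fun g => ?_)))
  change LinearMap.rTensor V (ψ ∘ₗ φ) ((f : 𝒢 → N ⊗[R] V) g) =
    LinearMap.rTensor V ψ (LinearMap.rTensor V φ ((f : 𝒢 → N ⊗[R] V) g))
  rw [LinearMap.rTensor_comp, LinearMap.comp_apply]

/-- The zero map is equivariant. [folklore] -/
theorem zero_equivariant' (q : Q) : (0 : N →ₗ[R] N') ∘ₗ ρ q = ρ' q ∘ₗ (0 : N →ₗ[R] N') := by
  rw [LinearMap.zero_comp, LinearMap.comp_zero]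

/-- `𝓕(0) = 0`. [folklore] -/
theorem inducedMap_zero :
    inducedMap ι τ hU' π ρ ρ' 0 (zero_equivariant' (ρ := ρ) (ρ' := ρ')) = 0 := by
  refine Rep.hom_ext (Representation.IntertwiningMap.ext (LinearMap.ext fun f => Subtype.ext
    (funext fun g => ?_)))
  change LinearMap.rTensor V (0 : N →ₗ[R] N') ((f : 𝒢 → N ⊗[R] V) g) = 0
  rw [LinearMap.rTensor_zero, LinearMap.zero_apply]

/-- Sums of equivariant maps are equivariant. [folklore] -/
theorem add_equivariant' {φ ψ : N →ₗ[R] N'} (hφ : ∀ q : Q, φ ∘ₗ ρ q = ρ' q ∘ₗ φ)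
    (hψ : ∀ q : Q, ψ ∘ₗ ρ q = ρ' q ∘ₗ ψ) (q : Q) : (φ + ψ) ∘ₗ ρ q = ρ' q ∘ₗ (φ + ψ) := by
  rw [LinearMap.add_comp, LinearMap.comp_add, hφ, hψ]

/-- **`𝓕(φ + ψ) = 𝓕(φ) + 𝓕(ψ)`.** [folklore] -/
theorem inducedMap_add (φ ψ : N →ₗ[R] N') (hφ : ∀ q : Q, φ ∘ₗ ρ q = ρ' q ∘ₗ φ)
    (hψ : ∀ q : Q, ψ ∘ₗ ρ q = ρ' q ∘ₗ ψ) :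
    inducedMap ι τ hU' π ρ ρ' (φ + ψ) (add_equivariant' hφ hψ) =
      inducedMap ι τ hU' π ρ ρ' φ hφ + inducedMap ι τ hU' π ρ ρ' ψ hψ := by
  refine Rep.hom_ext (Representation.IntertwiningMap.ext (LinearMap.ext fun f => Subtype.ext
    (funext fun g => ?_)))
  change LinearMap.rTensor V (φ + ψ) ((f : 𝒢 → N ⊗[R] V) g) =
    LinearMap.rTensor V φ ((f : 𝒢 → N ⊗[R] V) g) + LinearMap.rTensor V ψ ((f : 𝒢 → N ⊗[R] V) g)
  rw [LinearMap.rTensor_add, LinearMap.add_apply]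

/-- Scalar action of `R` on coefficients is equivariant. [folklore] -/
theorem smul_equivariant' {φ : N →ₗ[R] N'} (hφ : ∀ q : Q, φ ∘ₗ ρ q = ρ' q ∘ₗ φ) (c : R) (q : Q) :
    (c • φ) ∘ₗ ρ q = ρ' q ∘ₗ (c • φ) := by
  rw [LinearMap.smul_comp, LinearMap.comp_smul, hφ]

/-- **`𝓕(c • φ) = c • 𝓕(φ)`.** [folklore] -/
theorem inducedMap_smul (φ : N →ₗ[R] N') (hφ : ∀ q : Q, φ ∘ₗ ρ q = ρ' q ∘ₗ φ) (c : R) :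
    inducedMap ι τ hU' π ρ ρ' (c • φ) (smul_equivariant' hφ c) =
      c • inducedMap ι τ hU' π ρ ρ' φ hφ := by
  refine Rep.hom_ext (Representation.IntertwiningMap.ext (LinearMap.ext fun f => Subtype.ext
    (funext fun g => ?_)))
  change LinearMap.rTensor V (c • φ) ((f : 𝒢 → N ⊗[R] V) g) =
    c • LinearMap.rTensor V φ ((f : 𝒢 → N ⊗[R] V) g)
  rw [LinearMap.rTensor_smul, LinearMap.smul_apply]

/-- Two `𝓕(φ)` with equal underlying maps agree (proof irrelevance in the equivariance proof).
[folklore] -/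
theorem inducedMap_congr {φ ψ : N →ₗ[R] N'} (hφ : ∀ q : Q, φ ∘ₗ ρ q = ρ' q ∘ₗ φ)
    (hψ : ∀ q : Q, ψ ∘ₗ ρ q = ρ' q ∘ₗ ψ) (h : φ = ψ) :
    inducedMap ι τ hU' π ρ ρ' φ hφ = inducedMap ι τ hU' π ρ ρ' ψ hψ := by
  subst h; rfl

/-- **`𝓕` of a finite sum of equivariant maps is the sum of the `𝓕`'s.** [folklore] -/
theorem inducedMap_sum {T : Type*} (s : Finset T) (φ : T → (N →ₗ[R] N'))
    (hφ : ∀ t, ∀ q : Q, φ t ∘ₗ ρ q = ρ' q ∘ₗ φ t)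
    (hs : ∀ q : Q, (∑ t ∈ s, φ t) ∘ₗ ρ q = ρ' q ∘ₗ ∑ t ∈ s, φ t) :
    inducedMap ι τ hU' π ρ ρ' (∑ t ∈ s, φ t) hs = ∑ t ∈ s, inducedMap ι τ hU' π ρ ρ' (φ t) (hφ t) := by
  refine Rep.hom_ext (Representation.IntertwiningMap.ext (LinearMap.ext fun f => Subtype.ext
    (funext fun g => ?_)))
  rw [Rep.sum_hom, Representation.IntertwiningMap.toLinearMap_sum, LinearMap.sum_apply,
    AddSubmonoidClass.coe_finsetSum, Finset.sum_apply]
  change LinearMap.rTensor V (∑ t ∈ s, φ t) ((f : 𝒢 → N ⊗[R] V) g) =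
    ∑ t ∈ s, LinearMap.rTensor V (φ t) ((f : 𝒢 → N ⊗[R] V) g)
  clear hs
  induction s using Finset.cons_induction with
  | empty => simp
  | cons t s ht ih =>
    rw [Finset.sum_cons, Finset.sum_cons, LinearMap.rTensor_add, LinearMap.add_apply, ih]

/-! ### Exactness of `𝓕` -/

/-- If `ψ ∘ φ = 0` then `𝓕(φ) ≫ 𝓕(ψ) = 0`. [folklore] -/
theorem inducedMap_comp_eq_zero (φ : N →ₗ[R] N') (ψ : N' →ₗ[R] N'')
    (hφ : ∀ q : Q, φ ∘ₗ ρ q = ρ' q ∘ₗ φ) (hψ : ∀ q : Q, ψ ∘ₗ ρ' q = ρ'' q ∘ₗ ψ)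
    (h0 : ψ ∘ₗ φ = 0) :
    inducedMap ι τ hU' π ρ ρ' φ hφ ≫ inducedMap ι τ hU' π ρ' ρ'' ψ hψ = 0 :=
  pushforward_comp_pushforward_eq_zero ι _ _ _ _ _ _ _ (by
    rw [← LinearMap.rTensor_comp, h0, LinearMap.rTensor_zero])

/-- **`𝓕` is exact**: for `V` flat over `R` (e.g. free) and a short exact sequence
`0 → N →φ→ N' →ψ→ N'' → 0` of `Q`-modules with equivariant maps, the sequence
`0 → 𝓕(N) → 𝓕(N') → 𝓕(N'') → 0` is short exact in `Rep R Γ` (`- ⊗ V` is exact, then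
`shortExact_pushforward`).  This is the exactness of `C(U', M) ⊗_{𝒪[Δ̄]} -` of
[cite: KhareThorne2017, §6.3 (Lemma 6.9, Prop. 6.6)] at the level of coefficient sheaves. -/
theorem shortExact_inducedMap [Module.Flat R V] (φ : N →ₗ[R] N') (ψ : N' →ₗ[R] N'')
    (hφ : ∀ q : Q, φ ∘ₗ ρ q = ρ' q ∘ₗ φ) (hψ : ∀ q : Q, ψ ∘ₗ ρ' q = ρ'' q ∘ₗ ψ)
    (hinj : Function.Injective φ) (hsurj : Function.Surjective ψ) (hex : Function.Exact φ ψ) :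
    (ShortComplex.mk (inducedMap ι τ hU' π ρ ρ' φ hφ) (inducedMap ι τ hU' π ρ' ρ'' ψ hψ)
      (inducedMap_comp_eq_zero ι τ hU' π φ ψ hφ hψ
        (LinearMap.ext fun v => (hex (φ v)).2 ⟨v, rfl⟩))).ShortExact :=
  shortExact_pushforward ι _ _ _ level_le_self _ _ _ _
    (Module.Flat.rTensor_preserves_injective_linearMap φ hinj)
    (LinearMap.rTensor_surjective V hsurj) (Module.Flat.rTensor_exact V hex)

end Coeff

/-! ### The `U_p`-type operator on `𝓕(N)` -/

section Hecke

variable {N N' : Type} [AddCommGroup N] [Module R N] [AddCommGroup N'] [Module R N']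
  {ρ : Representation R Q N} {ρ' : Representation R Q N'}

variable {J : Type} [Fintype J] {a : J → 𝒢}

/-- The raw operator `F ↦ (g ↦ ∑_j (1 ⊗ τ(α_j)) F(g α_j))` on functions `𝒢 → N ⊗ V`. [folklore] -/
def inducedHeckeFun (ha : IsAdaptedFamily Δ U' π a) : (𝒢 → N ⊗[R] V) →ₗ[R] (𝒢 → N ⊗[R] V) :=
  ∑ j : J, ((τ ⟨a j, ha.mem j⟩).lTensor N).compLeft 𝒢 ∘ₗ
    LinearMap.funLeft R (N ⊗[R] V) fun g : 𝒢 => g * a j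

/-- Unfolding `inducedHeckeFun`. [folklore] -/
theorem inducedHeckeFun_apply (ha : IsAdaptedFamily Δ U' π a) (F : 𝒢 → N ⊗[R] V) (g : 𝒢) :
    inducedHeckeFun τ π ha F g = ∑ j : J, (τ ⟨a j, ha.mem j⟩).lTensor N (F (g * a j)) := by
  simp [inducedHeckeFun]

/-- The key step: for a section `F` of the induced system and `u ∈ U'` with
`u α_j = α_{j'} u'`, `π u' = π u`: `(1 ⊗ τ(α_j)) F(g u α_j) = (ρ(π u) ⊗ τ(u))⁻¹-twisted
(1 ⊗ τ(α_{j'})) F(g α_{j'})`, in the form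
`(ρ(πu) ⊗ τ(u)) ((1 ⊗ τ(α_j)) F(g u α_j)) = (1 ⊗ τ(α_{j'})) F(g α_{j'})`. [folklore] -/
theorem inducedCoeff_lTensor_apply_mul (ha : IsAdaptedFamily Δ U' π a)
    {F : 𝒢 → N ⊗[R] V} (hF : F ∈ sections U'.toSubmonoid (inducedCoeff τ hU' π ρ) U')
    (g : 𝒢) (u : U') {j j' : J} {u' : U'} (h : (u : 𝒢) * a j = a j' * u') (hπ : π u' = π u) :
    inducedCoeff τ hU' π ρ ⟨u, u.2⟩ ((τ ⟨a j, ha.mem j⟩).lTensor N (F (g * u * a j))) =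
      (τ ⟨a j', ha.mem j'⟩).lTensor N (F (g * a j')) := by
  -- `F(g u α_j) = F(g α_{j'} u') = (ρ(π u') ⊗ τ(u'))⁻¹ F(g α_{j'})`, i.e.
  -- `(ρ(πu') ⊗ τ(u')) F(g α_{j'} u') = F(g α_{j'})`
  have hsec := (mem_sections_iff (level_le_self (U' := U'))).1 hF (g * a j') u' u'.2
  have hmul : g * u * a j = g * a j' * u' := by rw [mul_assoc, h, ← mul_assoc]
  rw [hmul]
  -- compare both sides after writing `F(g α_{j'} u')` as `X`; apply the identity of operators
  -- `(ρ(πu) ⊗ τ(u)) ∘ (1 ⊗ τ(α_j)) = (1 ⊗ τ(α_{j'})) ∘ (ρ(πu') ⊗ τ(u'))` (from `u α_j = α_{j'} u'`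
  -- in `Δ` and `π u' = π u`)
  have hop : inducedCoeff τ hU' π ρ ⟨u, u.2⟩ ∘ₗ (τ ⟨a j, ha.mem j⟩).lTensor N =
      (τ ⟨a j', ha.mem j'⟩).lTensor N ∘ₗ inducedCoeff τ hU' π ρ ⟨u', u'.2⟩ := by
    refine TensorProduct.ext' fun n v => ?_
    simp only [LinearMap.comp_apply, LinearMap.lTensor_tmul, inducedCoeff_apply_tmul]
    have hΔ : (Submonoid.inclusion hU' ⟨(u : 𝒢), u.2⟩ : Δ) * ⟨a j, ha.mem j⟩ =
        ⟨a j', ha.mem j'⟩ * Submonoid.inclusion hU' ⟨(u' : 𝒢), u'.2⟩ :=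
      Subtype.ext h
    have hτ : τ (Submonoid.inclusion hU' ⟨(u : 𝒢), u.2⟩) (τ ⟨a j, ha.mem j⟩ v) =
        τ ⟨a j', ha.mem j'⟩ (τ (Submonoid.inclusion hU' ⟨(u' : 𝒢), u'.2⟩) v) := by
      rw [← Module.End.mul_apply, ← map_mul, hΔ, map_mul, Module.End.mul_apply]
    have hu : toSubgroupHom U' ⟨(u : 𝒢), u.2⟩ = u := rfl
    have hu' : toSubgroupHom U' ⟨(u' : 𝒢), u'.2⟩ = u' := rfl
    rw [hτ, hu, hu', hπ]
  have h1 := LinearMap.congr_fun hop (F (g * a j' * u'))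
  simp only [LinearMap.comp_apply] at h1
  rw [h1, hsec]

/-- **`inducedHeckeFun` preserves the sections of the induced system.** [cite: KhareThorne2017, §6.3, Lemma 6.5] -/
theorem inducedHeckeFun_mem_sections (ha : IsAdaptedFamily Δ U' π a) {F : 𝒢 → N ⊗[R] V}
    (hF : F ∈ sections U'.toSubmonoid (inducedCoeff τ hU' π ρ) U') :
    inducedHeckeFun τ π ha F ∈ sections U'.toSubmonoid (inducedCoeff τ hU' π ρ) U' := by
  rw [mem_sections_iff (level_le_self (U' := U'))]
  intro g u hu
  obtain ⟨σ, hσ⟩ := ha.perm ⟨u, hu⟩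
  rw [inducedHeckeFun_apply, inducedHeckeFun_apply, map_sum]
  -- termwise `(ρ(πu) ⊗ τ(u)) (1 ⊗ τ(α_j)) F(g u α_j) = (1 ⊗ τ(α_{σ j})) F(g α_{σ j})`, then reindex
  have hterm : ∀ j, inducedCoeff τ hU' π ρ ⟨u, hu⟩ ((τ ⟨a j, ha.mem j⟩).lTensor N (F (g * u * a j))) =
      (τ ⟨a (σ j), ha.mem (σ j)⟩).lTensor N (F (g * a (σ j))) := fun j => by
    obtain ⟨u', h, hπ⟩ := hσ j
    exact inducedCoeff_lTensor_apply_mul τ hU' π ha hF g ⟨u, hu⟩ h hπ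
  rw [Finset.sum_congr rfl fun j _ => hterm j]
  exact Equiv.sum_comp σ (fun j => (τ ⟨a j, ha.mem j⟩).lTensor N (F (g * a j)))

/-- Left translations commute with `inducedHeckeFun`. [folklore] -/
theorem inducedHeckeFun_leftTranslation (ha : IsAdaptedFamily Δ U' π a) (γ : Γ)
    (F : 𝒢 → N ⊗[R] V) :
    inducedHeckeFun τ π ha (leftTranslation R ι (N ⊗[R] V) γ F) =
      leftTranslation R ι (N ⊗[R] V) γ (inducedHeckeFun τ π ha F) := by
  funext g
  simp only [inducedHeckeFun_apply, leftTranslation_apply, mul_assoc]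

variable (ρ) in
/-- **The `U_p`-type operator `∑_j (1 ⊗ τ(α_j)) F(· α_j)` on `𝓕(N)`** as an endomorphism of
`Γ`-representations. [cite: KhareThorne2017, §6.3, Lemma 6.5] -/
def inducedHecke (ha : IsAdaptedFamily Δ U' π a) :
    inducedRep ι τ hU' π ρ ⟶ inducedRep ι τ hU' π ρ :=
  Rep.ofHom ⟨(inducedHeckeFun τ π ha).restrict fun _ hF =>
      inducedHeckeFun_mem_sections τ hU' π ha hF,
    fun γ => LinearMap.ext fun F => Subtype.ext (by
      simp only [LinearMap.coe_comp, Function.comp_apply, LinearMap.coe_restrict_apply, coe_rep_apply]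
      exact inducedHeckeFun_leftTranslation ι τ π ha γ (F : 𝒢 → N ⊗[R] V))⟩

/-- Unfolding `inducedHecke` pointwise. [folklore] -/
@[simp]
theorem inducedHecke_hom_apply_coe (ha : IsAdaptedFamily Δ U' π a) (F : inducedRep ι τ hU' π ρ)
    (g : 𝒢) :
    (((inducedHecke ι τ hU' π ρ ha).hom F :
      sections U'.toSubmonoid (inducedCoeff τ hU' π ρ) U') : 𝒢 → N ⊗[R] V) g =
      ∑ j : J, (τ ⟨a j, ha.mem j⟩).lTensor N ((F : 𝒢 → N ⊗[R] V) (g * a j)) :=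
  inducedHeckeFun_apply τ π ha _ g

/-- **Naturality of the `U_p`-type operator in the coefficients**: `𝓕(φ) ∘ U = U ∘ 𝓕(φ)`.
[folklore] -/
theorem inducedHecke_comp_inducedMap (ha : IsAdaptedFamily Δ U' π a) (φ : N →ₗ[R] N')
    (hφ : ∀ q : Q, φ ∘ₗ ρ q = ρ' q ∘ₗ φ) :
    inducedHecke ι τ hU' π ρ ha ≫ inducedMap ι τ hU' π ρ ρ' φ hφ =
      inducedMap ι τ hU' π ρ ρ' φ hφ ≫ inducedHecke ι τ hU' π ρ' ha := by
  refine Rep.hom_ext (Representation.IntertwiningMap.ext (LinearMap.ext fun F => Subtype.ext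
    (funext fun g => ?_)))
  change φ.rTensor V ((((inducedHecke ι τ hU' π ρ ha).hom F :
      sections U'.toSubmonoid (inducedCoeff τ hU' π ρ) U') : 𝒢 → N ⊗[R] V) g) =
    (((inducedHecke ι τ hU' π ρ' ha).hom ((inducedMap ι τ hU' π ρ ρ' φ hφ).hom F) :
      sections U'.toSubmonoid (inducedCoeff τ hU' π ρ') U') : 𝒢 → N' ⊗[R] V) g
  rw [inducedHecke_hom_apply_coe, inducedHecke_hom_apply_coe, map_sum]
  refine Finset.sum_congr rfl fun j _ => ?_
  rw [inducedMap_hom_apply_coe, ← LinearMap.comp_apply, ← LinearMap.comp_apply,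
    LinearMap.rTensor_comp_lTensor, LinearMap.lTensor_comp_rTensor]

/-- The `U_p`-type operator on `H^i(Γ, 𝓕(N))`. [folklore] -/
abbrev inducedHeckeCohomology (ha : IsAdaptedFamily Δ U' π a) (i : ℕ) :
    Module.End R (inducedCohomology ι τ hU' π ρ i) :=
  (groupCohomology.map (MonoidHom.id Γ) (inducedHecke ι τ hU' π ρ ha) i).hom

/-- **Naturality on cohomology**: `H^i(𝓕(φ)) ∘ U = U ∘ H^i(𝓕(φ))`. [folklore] -/
theorem inducedHeckeCohomology_comp (ha : IsAdaptedFamily Δ U' π a) (φ : N →ₗ[R] N')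
    (hφ : ∀ q : Q, φ ∘ₗ ρ q = ρ' q ∘ₗ φ) (i : ℕ) :
    (groupCohomology.map (MonoidHom.id Γ) (inducedMap ι τ hU' π ρ ρ' φ hφ) i).hom ∘ₗ
        inducedHeckeCohomology ι τ hU' π ha i =
      inducedHeckeCohomology ι τ hU' π ha i ∘ₗ
        (groupCohomology.map (MonoidHom.id Γ) (inducedMap ι τ hU' π ρ ρ' φ hφ) i).hom := by
  dsimp only [inducedHeckeCohomology]
  rw [← ModuleCat.hom_comp, ← ModuleCat.hom_comp, ← groupCohomology.map_id_comp,
    ← groupCohomology.map_id_comp, inducedHecke_comp_inducedMap]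

end Hecke

end LevelAction

end Literature.NumberTheory.Automorphic
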